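import Mathlib.Data.Sym.Card
import Mathlib.Data.Fintype.Vector
import Summits.ValiantsHypothesis.ValiantsHypothesis.Theorems.LacunarySymmetroidMatrixDescartesCensusTropicalKLawSlopes

/-!
# Route `KPlusLogSqLaw`, crux `TropicalB` — UNSIGNED dominant chains and HESSENBERG designs (definitions)

HONEST FRAMING.  Definitions file toward the registered stubs `stub_tropThin` / `stub_tropFat` of
`Cruxes/TropicalB/Lines/birth.lean` (crux `Summit.ValiantsHypothesis.ValiantsHypothesis.Theses.KPlusLogSqLaw.TropicalB`,
ledger item `stmt-ValiantsHypothesis-19771`, route `KPlusLogSqLaw`, DRAFT; cell `pub-symmetroid`, seat `val-sym-trop-p1`,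
2026-08-26).  Nothing here proves any part of a stub and nothing asserts `TropicalB`, `KPlusLogSqLaw`, `MatrixDescartes`
or anything about `VP ≠ VNP`.

Why these definitions.  Every upper bound for the tropical census row `TropicalCensus.TropRootLawAt m K B` in the tree is
COUNTING (slopes of a sign-alternating dominant chain are pairwise distinct class multisets).  A Gusfield-type
DECOMPOSITION bound (split the columns, control the row set used by the first block) recurses through sub-designs whose
induced chains are dominant but NOT sign-alternating; so the recursion has to run on the UNSIGNED row, and Hessenberg
(= DAG-path) support is the class on which the number of block states is linear instead of binomial.  This file only
fixes the vocabulary and its elementary calibration; the split theorem and its corollaries are separate proof files.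

* `DesignRowD d v ε B`  — the unsigned row bound of ONE design: every chain of terms dominant at strictly increasing
  integer slopes with CONSECUTIVE TERMS DISTINCT has at most `B` breakpoints (no sign condition, no `|ε| ≤ 1`).
* `TropRowD m K B`      — the same for every design of format `(m, K)`.
* `IsHessenberg ε`      — Hessenberg support: an entry `(a, b)` (row `a`, column `b`) can be present only if `a ≤ b + 1`.
  The present Leibniz permutations of such a design are the products of consecutive cycles `(u u+1 … w)`, i.e. the
  interval partitions of `[0, m)` = the `0 → m` paths of the transitive DAG on `{0, …, m}`: Hessenberg designs are exactly
  `K`-slope-class parametric shortest-path instances on DAGs (Carstensen 1983 / Gusfield 1980 setting), and contain the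
  tree's staircase families.
* Calibration (all [folklore]): `tropRootLawAt_of_tropRowD` (a sign-alternating chain has distinct consecutive terms, so the
  unsigned row bounds the signed row `TropRootLawAt`), `designRowD_mono`, `tropRowD_mono`, `slope_strictMono_of_chainD` /
  `injective_of_chainD` (slopes strictly increase along an unsigned chain), `tropRowD_slopeCount` (the counting bound
  `multichoose K m − 1` holds unsigned), `designRowD_of_tropRowD`.
-/

set_option linter.dupNamespace false
set_option autoImplicit false

namespace Summit.ValiantsHypothesis.ValiantsHypothesis.Theorems.KPlusLogSqLaw

open Summit.ValiantsHypothesis.ValiantsHypothesis.Theorems.MatrixDescartes.Negative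
open Summit.ValiantsHypothesis.ValiantsHypothesis.Theorems.LacunarySymmetroidMatrixDescartes
open Summit.ValiantsHypothesis.ValiantsHypothesis.Theorems.LacunarySymmetroidMatrixDescartes.TropicalCensus
open scoped BigOperators
open Finset

/-! ## 1. Definitions -/

/-- **Unsigned row bound of one design.**  `DesignRowD d v ε B`: for the tropical design `(d, v, ε)`, every chain
`p₀, …, pₙ` of Leibniz terms that are unique optima (`IsDominant`) at strictly increasing integer slopes `θ₀ < ⋯ < θₙ`,
with consecutive terms distinct, has `n ≤ B`.  No sign condition and no bound on `|ε|` is imposed (dominance only sees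
which entries are present). [definition of the cell] -/
def DesignRowD {m K : ℕ} (d : Fin K → ℕ) (v ε : Fin m → Fin m → Fin K → ℤ) (B : ℕ) : Prop :=
  ∀ (n : ℕ) (θ : Fin (n + 1) → ℤ) (p : Fin (n + 1) → Equiv.Perm (Fin m) × (Fin m → Fin K)),
    StrictMono θ → (∀ k, IsDominant d v ε (θ k) (p k)) → (∀ k : Fin n, p k.castSucc ≠ p k.succ) → n ≤ B

/-- **Unsigned tropical row.**  `TropRowD m K B`: every design of format `(m, K)` satisfies `DesignRowD … B`.
[definition of the cell] -/
def TropRowD (m K B : ℕ) : Prop :=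
  ∀ (d : Fin K → ℕ) (v ε : Fin m → Fin m → Fin K → ℤ), DesignRowD d v ε B

/-- **Hessenberg support.**  `IsHessenberg ε`: the entry in row `a` and column `b` carries a present class only if
`a ≤ b + 1` (upper Hessenberg together with the subdiagonal).  Present permutations are then interval partitions of
`[0, m)` (products of consecutive cycles), i.e. source–sink paths of a DAG: the parametric-shortest-path class.
[definition of the cell] -/
def IsHessenberg {m K : ℕ} (ε : Fin m → Fin m → Fin K → ℤ) : Prop :=
  ∀ a b l, ε a b l ≠ 0 → (a : ℕ) ≤ (b : ℕ) + 1

/-! ## 2. Calibration -/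

section Calibration

variable {m K : ℕ}

/-- Monotonicity of the unsigned row bound of a design in the bound. [folklore] -/
theorem designRowD_mono {d : Fin K → ℕ} {v ε : Fin m → Fin m → Fin K → ℤ} {B B' : ℕ} (hBB' : B ≤ B')
    (h : DesignRowD d v ε B) : DesignRowD d v ε B' :=
  fun n θ p hθ hdom hne => (h n θ p hθ hdom hne).trans hBB'

/-- Monotonicity of the unsigned row in the bound. [folklore] -/
theorem tropRowD_mono {B B' : ℕ} (hBB' : B ≤ B') (h : TropRowD m K B) : TropRowD m K B' :=
  fun d v ε => designRowD_mono hBB' (h d v ε)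

/-- the unsigned row specialises to each design. [folklore] -/
theorem designRowD_of_tropRowD {B : ℕ} (h : TropRowD m K B) (d : Fin K → ℕ) (v ε : Fin m → Fin m → Fin K → ℤ) :
    DesignRowD d v ε B :=
  h d v ε

/-- A sign-alternating chain has distinct consecutive terms. [folklore] -/
theorem ne_succ_of_alternating (ε : Fin m → Fin m → Fin K → ℤ) {n : ℕ}
    (p : Fin (n + 1) → Equiv.Perm (Fin m) × (Fin m → Fin K))
    (halt : ∀ k : Fin n, termSign ε (p k.castSucc) * termSign ε (p k.succ) < 0) (k : Fin n) :
    p k.castSucc ≠ p k.succ := by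
  intro h
  have := halt k
  rw [h] at this
  exact absurd this (not_lt.mpr (mul_self_nonneg _))

/-- **The unsigned row bounds the signed row**: `TropRowD m K B → TropRootLawAt m K B`. [folklore] -/
theorem tropRootLawAt_of_tropRowD {B : ℕ} (h : TropRowD m K B) : TropRootLawAt m K B :=
  fun d v ε n θ p _ hθ hdom halt => h d v ε n θ p hθ hdom (ne_succ_of_alternating ε p halt)

/-- the unsigned row of a design bounds its sign-alternating chains. [folklore] -/
theorem le_of_designRowD {d : Fin K → ℕ} {v ε : Fin m → Fin m → Fin K → ℤ} {B : ℕ} (h : DesignRowD d v ε B)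
    {n : ℕ} (θ : Fin (n + 1) → ℤ) (p : Fin (n + 1) → Equiv.Perm (Fin m) × (Fin m → Fin K))
    (hθ : StrictMono θ) (hdom : ∀ k, IsDominant d v ε (θ k) (p k))
    (halt : ∀ k : Fin n, termSign ε (p k.castSucc) * termSign ε (p k.succ) < 0) : n ≤ B :=
  h n θ p hθ hdom (ne_succ_of_alternating ε p halt)

/-- **Slopes strictly increase along an unsigned chain** (`slope_lt_of_dominant` step by step). [folklore] -/
theorem slope_strictMono_of_chainD (d : Fin K → ℕ) (v ε : Fin m → Fin m → Fin K → ℤ) {n : ℕ}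
    (θ : Fin (n + 1) → ℤ) (p : Fin (n + 1) → Equiv.Perm (Fin m) × (Fin m → Fin K))
    (hθ : StrictMono θ) (hdom : ∀ k, IsDominant d v ε (θ k) (p k)) (hne : ∀ k : Fin n, p k.castSucc ≠ p k.succ) :
    StrictMono fun k => TropicalCensus.slope d (p k) := by
  rw [Fin.strictMono_iff_lt_succ]
  intro k
  exact slope_lt_of_dominant d v ε (hθ Fin.castSucc_lt_succ) (hne k) (hdom _) (hdom _)

/-- the terms of an unsigned chain are pairwise distinct. [folklore] -/
theorem injective_of_chainD (d : Fin K → ℕ) (v ε : Fin m → Fin m → Fin K → ℤ) {n : ℕ}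
    (θ : Fin (n + 1) → ℤ) (p : Fin (n + 1) → Equiv.Perm (Fin m) × (Fin m → Fin K))
    (hθ : StrictMono θ) (hdom : ∀ k, IsDominant d v ε (θ k) (p k)) (hne : ∀ k : Fin n, p k.castSucc ≠ p k.succ) :
    Function.Injective p := by
  intro a b hab
  exact (slope_strictMono_of_chainD d v ε θ p hθ hdom hne).injective (by simp only [hab])

/-- two dominant terms of an unsigned chain with equal slopes are equal (contrapositive of `slope_lt_of_dominant`). [folklore] -/
theorem eq_of_slope_eq_of_dominant (d : Fin K → ℕ) (v ε : Fin m → Fin m → Fin K → ℤ) {θa θb : ℤ} (hab : θa < θb)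
    {p p' : Equiv.Perm (Fin m) × (Fin m → Fin K)} (ha : IsDominant d v ε θa p) (hb : IsDominant d v ε θb p')
    (h : TropicalCensus.slope d p = TropicalCensus.slope d p') : p = p' := by
  by_contra hne
  exact absurd h (ne_of_lt (slope_lt_of_dominant d v ε hab hne ha hb))

/-- **Unsigned slope counting**: `TropRowD m K (multichoose K m − 1)` — the class multisets along an unsigned chain are
pairwise distinct (same proof as the tree's signed `tropRootLawAt_slopeCount`). [folklore] -/
theorem tropRowD_slopeCount (m K : ℕ) : TropRowD m K (Nat.multichoose K m - 1) := by
  intro d v ε n θ p hθ hdom hne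
  have hsm := slope_strictMono_of_chainD d v ε θ p hθ hdom hne
  have hinj : Function.Injective fun k => classSym (p k) := by
    intro k k' h
    apply hsm.injective
    simp only
    rw [slope_eq_of_classSym, slope_eq_of_classSym]
    exact congrArg (fun M : Sym (Fin K) m => ((M : Multiset (Fin K)).map fun l => (d l : ℤ)).sum) h
  have hcard := Fintype.card_le_of_injective _ hinj
  rw [Fintype.card_fin, Sym.card_sym_eq_multichoose, Fintype.card_fin] at hcard
  omega

/-- unsigned slope counting in binomial form. [folklore] -/
theorem tropRowD_choose (m K : ℕ) : TropRowD m K ((K + m - 1).choose m - 1) := by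
  rw [← Nat.multichoose_eq]; exact tropRowD_slopeCount m K

/-- With no class (`K = 0`) an unsigned chain has no breakpoint. [folklore] -/
theorem tropRowD_zero (m B : ℕ) : TropRowD m 0 B := by
  refine tropRowD_mono (Nat.zero_le _) ?_
  have h := tropRowD_slopeCount m 0
  rcases m with _ | m
  · simpa using h
  · rw [Nat.multichoose_zero_succ] at h; simpa using h

/-- A `1 × 1` design: an unsigned chain uses pairwise distinct classes at the single entry, so `n ≤ K − 1`. [folklore] -/
theorem tropRowD_one (K : ℕ) : TropRowD 1 K (K - 1) := by
  have h := tropRowD_slopeCount 1 K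
  rwa [Nat.multichoose_one_right] at h

/-- The empty design (`m = 0`) has exactly one term: no breakpoint. [folklore] -/
theorem tropRowD_size_zero (K B : ℕ) : TropRowD 0 K B := by
  refine tropRowD_mono (Nat.zero_le _) ?_
  have h := tropRowD_slopeCount 0 K
  simpa using h

end Calibration

end Summit.ValiantsHypothesis.ValiantsHypothesis.Theorems.KPlusLogSqLaw
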